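import Mathlib
import Summits.SmoothPoincare4.SmoothPoincare4.Theses.CongruenceShadows
import Summits.SmoothPoincare4.SmoothPoincare4.Theorems.ShadowsStandard.Negative.ShadowLevels
import Summits.SmoothPoincare4.SmoothPoincare4.Theorems.WaldhausenPairs.Negative.PairTransferFalse
import Summits.SmoothPoincare4.SmoothPoincare4.Theorems.WaldhausenPairs.Negative.StandardPairSymmetries

/-!
# drefute work file for line `power-twist-absorption` (crux stmt-SmoothPoincare4-14593,
`CongruenceShadows.ShadowsStandard`): STUB 2 proved (§P) + load-bearing analysis of STUB 1 (§N)

The definitions `Sg`, `CongruentMod`, `h0`, `IsStdTwist`, `boundaryWord`, `IsSepTwist`,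
`IsDehnTwist`, `powerTwists`, `congruenceKernel` and the lemmas `CongruentMod.mul/inv/conj`,
`congruenceKernel_normal`, `congruentMod_of_generators` are copied VERBATIM from the skeleton
`Cruxes/ShadowsStandard/Lines/power-twist-absorption.lean` (same namespace), so that the final
theorem `twistAbsorption_proof : TwistAbsorption` can be pasted under `stub_twistAbsorption`.

New content (§P): powers of a standard transvection / of a separating partial conjugation on
generators (`pow_apply_of_isStdTwist_*`, `apply_boundaryWord_of_isSepTwist`,
`pow_apply_of_isSepTwist_*`), congruence of `T₀ ^ e` (`congruentMod_pow_of_isStdTwist`,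
`congruentMod_pow_of_isSepTwist`), and the normal-closure argument (`twistAbsorption_proof`).
Refuter seat `refuter-drefute-stmt-SmoothPoincare4-14593-0`, 2026-08-16. Positive lemma: attached as
item evidence only (not landed by the refuter).
-/

set_option linter.dupNamespace false

noncomputable section

namespace Summit.SmoothPoincare4.SmoothPoincare4.Cruxes.ShadowsStandard.PowerTwistAbsorption

open Literature.Topology.FourManifolds Subgroup

/-! ## Copied verbatim from the skeleton (§1–§3 fragments) -/

abbrev Sg (m : ℕ) : Type := SurfaceGroup (3 + 3 * m)

def CongruentMod {m : ℕ} (M : Subgroup (Sg m)) (φ : Sg m ≃* Sg m) : Prop :=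
  ∀ s : Sg m, φ s * s⁻¹ ∈ M

theorem congruentMod_one {m : ℕ} (M : Subgroup (Sg m)) : CongruentMod M 1 := by
  intro s
  simp [M.one_mem]

theorem CongruentMod.mul {m : ℕ} {M : Subgroup (Sg m)} {φ ψ : Sg m ≃* Sg m}
    (hφ : CongruentMod M φ) (hψ : CongruentMod M ψ) : CongruentMod M (φ * ψ) := by
  intro s
  have h : (φ * ψ) s * s⁻¹ = (φ (ψ s) * (ψ s)⁻¹) * (ψ s * s⁻¹) := by
    rw [MulAut.mul_apply]; group
  rw [h]
  exact M.mul_mem (hφ (ψ s)) (hψ s)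

theorem CongruentMod.inv {m : ℕ} {M : Subgroup (Sg m)} {φ : Sg m ≃* Sg m}
    (hφ : CongruentMod M φ) : CongruentMod M φ⁻¹ := by
  intro s
  have h1 : φ (φ⁻¹ s) * (φ⁻¹ s)⁻¹ ∈ M := hφ (φ⁻¹ s)
  rw [MulAut.apply_inv_self] at h1
  have h2 := M.inv_mem h1
  simpa using h2

theorem CongruentMod.conj {m : ℕ} {M : Subgroup (Sg m)} (hM : M.Characteristic)
    {φ : Sg m ≃* Sg m} (hφ : CongruentMod M φ) (α : Sg m ≃* Sg m) :
    CongruentMod M (α * φ * α⁻¹) := by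
  intro s
  have h1 : φ (α⁻¹ s) * (α⁻¹ s)⁻¹ ∈ M := hφ _
  have h2 : φ (α⁻¹ s) * (α⁻¹ s)⁻¹ ∈ M.comap α.toMonoidHom := by
    rw [hM.fixed α]; exact h1
  rw [Subgroup.mem_comap] at h2
  simpa [MulAut.mul_apply, map_mul, map_inv, MulAut.apply_inv_self] using h2

def congruenceKernel {m : ℕ} (M : Subgroup (Sg m)) : Subgroup (Sg m ≃* Sg m) where
  carrier := {φ | CongruentMod M φ}
  mul_mem' := fun ha hb => CongruentMod.mul ha hb
  one_mem' := congruentMod_one M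
  inv_mem' := fun ha => CongruentMod.inv ha

@[simp] theorem mem_congruenceKernel {m : ℕ} {M : Subgroup (Sg m)} {φ : Sg m ≃* Sg m} :
    φ ∈ congruenceKernel M ↔ CongruentMod M φ := Iff.rfl

theorem congruenceKernel_normal {m : ℕ} {M : Subgroup (Sg m)} (hM : M.Characteristic) :
    (congruenceKernel M).Normal :=
  ⟨fun _ hφ α => CongruentMod.conj hM hφ α⟩

theorem congruentMod_of_generators {m : ℕ} {M : Subgroup (Sg m)} [M.Normal] {φ : Sg m ≃* Sg m}
    (h : ∀ x : surfaceGen (3 + 3 * m),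
      φ (PresentedGroup.of x) * (PresentedGroup.of x)⁻¹ ∈ M) :
    CongruentMod M φ := by
  let H : Subgroup (Sg m) :=
    { carrier := {s | φ s * s⁻¹ ∈ M}
      mul_mem' := by
        intro s t hs ht
        have e : φ (s * t) * (s * t)⁻¹ = (φ s * s⁻¹) * (s * (φ t * t⁻¹) * s⁻¹) := by
          rw [map_mul]; group
        change φ (s * t) * (s * t)⁻¹ ∈ M
        rw [e]
        exact M.mul_mem hs (Subgroup.Normal.conj_mem inferInstance _ ht s)
      one_mem' := by
        change φ 1 * (1 : Sg m)⁻¹ ∈ M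
        simp [M.one_mem]
      inv_mem' := by
        intro s hs
        change φ s⁻¹ * s⁻¹⁻¹ ∈ M
        have h1 : s * (φ s)⁻¹ ∈ M := by simpa using M.inv_mem hs
        have h2 : s⁻¹ * (s * (φ s)⁻¹) * s⁻¹⁻¹ ∈ M := Subgroup.Normal.conj_mem inferInstance _ h1 s⁻¹
        simpa [map_inv, mul_assoc] using h2 }
  intro s
  exact PresentedGroup.generated_by _ H h s

def h0 (m : ℕ) : Fin (3 + 3 * m) := ⟨0, by omega⟩

def IsStdTwist {m : ℕ} (T : Sg m ≃* Sg m) : Prop :=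
  ∀ x : surfaceGen (3 + 3 * m),
    T (PresentedGroup.of x) =
      if x = (h0 m, true) then PresentedGroup.of (h0 m, true) * PresentedGroup.of (h0 m, false)
      else PresentedGroup.of x

def boundaryWord (m h : ℕ) : Sg m :=
  PresentedGroup.mk _ ((((List.finRange (3 + 3 * m)).filter fun i => i.val < h).map
    fun i => genA i * genB i * (genA i)⁻¹ * (genB i)⁻¹).prod)

def IsSepTwist {m : ℕ} (h : ℕ) (T : Sg m ≃* Sg m) : Prop :=
  ∀ x : surfaceGen (3 + 3 * m),
    T (PresentedGroup.of x) =
      if x.1.val < h then boundaryWord m h * PresentedGroup.of x * (boundaryWord m h)⁻¹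
      else PresentedGroup.of x

def IsDehnTwist {m : ℕ} (T : Sg m ≃* Sg m) : Prop :=
  ∃ φ T₀ : Sg m ≃* Sg m, (IsStdTwist T₀ ∨ ∃ h : ℕ, IsSepTwist h T₀) ∧ T = φ * T₀ * φ⁻¹

def powerTwists (m e : ℕ) : Subgroup (Sg m ≃* Sg m) :=
  Subgroup.normalClosure {t | ∃ T : Sg m ≃* Sg m, IsDehnTwist T ∧ t = T ^ e}

def TwistAbsorption : Prop :=
  ∀ (m e : ℕ) (M : Subgroup (Sg m)), M.Characteristic → (∀ s : Sg m, s ^ e ∈ M) →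
    ∀ t : Sg m ≃* Sg m, t ∈ powerTwists m e → CongruentMod M t

/-! ## §P  The proof of STUB 2 -/

/-- Powers of a standard transvection fix every generator other than `b₁`. -/
theorem pow_apply_of_isStdTwist_ne {m : ℕ} {T : Sg m ≃* Sg m} (hT : IsStdTwist T) (e : ℕ)
    {x : surfaceGen (3 + 3 * m)} (hx : x ≠ (h0 m, true)) :
    (T ^ e) (PresentedGroup.of x) = PresentedGroup.of x := by
  induction e with
  | zero => simp
  | succ n ih =>
    rw [pow_succ, MulAut.mul_apply, hT x, if_neg hx, ih]

/-- Powers of a standard transvection on `b₁`: `T^e(b₁) = b₁ a₁^e`. -/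
theorem pow_apply_of_isStdTwist_self {m : ℕ} {T : Sg m ≃* Sg m} (hT : IsStdTwist T) (e : ℕ) :
    (T ^ e) (PresentedGroup.of (h0 m, true)) =
      PresentedGroup.of (h0 m, true) * PresentedGroup.of (h0 m, false) ^ e := by
  induction e with
  | zero => simp
  | succ n ih =>
    have hne : ((h0 m, false) : surfaceGen (3 + 3 * m)) ≠ (h0 m, true) := by simp
    rw [pow_succ, MulAut.mul_apply, hT (h0 m, true), if_pos rfl, map_mul, ih,
      pow_apply_of_isStdTwist_ne hT n hne, pow_succ, mul_assoc]

/-- `T₀ ^ e ≡ id (mod M)` for the standard transvection, if `M ◁ S` contains all `e`-th powers. -/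
theorem congruentMod_pow_of_isStdTwist {m : ℕ} {M : Subgroup (Sg m)} [M.Normal]
    {T : Sg m ≃* Sg m} (hT : IsStdTwist T) {e : ℕ} (he : ∀ s : Sg m, s ^ e ∈ M) :
    CongruentMod M (T ^ e) := by
  refine congruentMod_of_generators ?_
  intro x
  by_cases hx : x = (h0 m, true)
  · subst hx
    rw [pow_apply_of_isStdTwist_self hT e]
    exact Subgroup.Normal.conj_mem inferInstance _ (he _) _
  · rw [pow_apply_of_isStdTwist_ne hT e hx, mul_inv_cancel]
    exact M.one_mem

/-- A separating partial conjugation fixes its own boundary word: `T(w_h) = w_h`. -/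
theorem apply_boundaryWord_of_isSepTwist {m : ℕ} {h : ℕ} {T : Sg m ≃* Sg m}
    (hT : IsSepTwist h T) : T (boundaryWord m h) = boundaryWord m h := by
  set w : Sg m := boundaryWord m h with hw
  -- the subgroup on which `T` acts as conjugation by `w`
  let H : Subgroup (Sg m) :=
    { carrier := {s | T s = w * s * w⁻¹}
      mul_mem' := by
        intro s t hs ht
        change T (s * t) = w * (s * t) * w⁻¹
        change T s = w * s * w⁻¹ at hs
        change T t = w * t * w⁻¹ at ht
        rw [map_mul, hs, ht]; group
      one_mem' := by
        change T 1 = w * 1 * w⁻¹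
        simp
      inv_mem' := by
        intro s hs
        change T s⁻¹ = w * s⁻¹ * w⁻¹
        change T s = w * s * w⁻¹ at hs
        rw [map_inv, hs]; group }
  have hgen : ∀ x : surfaceGen (3 + 3 * m), x.1.val < h → (PresentedGroup.of x : Sg m) ∈ H := by
    intro x hx
    change T (PresentedGroup.of x) = w * PresentedGroup.of x * w⁻¹
    rw [hT x, if_pos hx]
  have hwH : w ∈ H := by
    rw [hw, boundaryWord, map_list_prod]
    refine Subgroup.list_prod_mem _ ?_
    intro y hy
    rw [List.map_map, List.mem_map] at hy
    obtain ⟨i, hi, rfl⟩ := hy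
    rw [List.mem_filter] at hi
    have hi' : i.val < h := by simpa using hi.2
    have ha : (PresentedGroup.of (i, false) : Sg m) ∈ H := hgen (i, false) hi'
    have hb : (PresentedGroup.of (i, true) : Sg m) ∈ H := hgen (i, true) hi'
    change PresentedGroup.mk _ (genA i * genB i * (genA i)⁻¹ * (genB i)⁻¹) ∈ H
    rw [map_mul, map_mul, map_mul, map_inv, map_inv]
    exact H.mul_mem (H.mul_mem (H.mul_mem ha hb) (H.inv_mem ha)) (H.inv_mem hb)
  have key : T w = w * w * w⁻¹ := hwH
  rw [key, mul_inv_cancel_right]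

/-- Powers of a separating partial conjugation fix the boundary word. -/
theorem pow_apply_boundaryWord_of_isSepTwist {m : ℕ} {h : ℕ} {T : Sg m ≃* Sg m}
    (hT : IsSepTwist h T) (n : ℕ) : (T ^ n) (boundaryWord m h) = boundaryWord m h := by
  induction n with
  | zero => simp
  | succ n ih => rw [pow_succ, MulAut.mul_apply, apply_boundaryWord_of_isSepTwist hT, ih]

/-- Powers of a separating partial conjugation on the conjugated generators. -/
theorem pow_apply_of_isSepTwist_lt {m : ℕ} {h : ℕ} {T : Sg m ≃* Sg m} (hT : IsSepTwist h T)
    (n : ℕ) {x : surfaceGen (3 + 3 * m)} (hx : x.1.val < h) :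
    (T ^ n) (PresentedGroup.of x) =
      boundaryWord m h ^ n * PresentedGroup.of x * (boundaryWord m h ^ n)⁻¹ := by
  induction n with
  | zero => simp
  | succ n ih =>
    rw [pow_succ, MulAut.mul_apply, hT x, if_pos hx, map_mul, map_mul, map_inv,
      pow_apply_boundaryWord_of_isSepTwist hT n, ih, pow_succ', mul_inv_rev]
    group

/-- Powers of a separating partial conjugation fix the other generators. -/
theorem pow_apply_of_isSepTwist_not_lt {m : ℕ} {h : ℕ} {T : Sg m ≃* Sg m}
    (hT : IsSepTwist h T) (n : ℕ) {x : surfaceGen (3 + 3 * m)} (hx : ¬ x.1.val < h) :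
    (T ^ n) (PresentedGroup.of x) = PresentedGroup.of x := by
  induction n with
  | zero => simp
  | succ n ih => rw [pow_succ, MulAut.mul_apply, hT x, if_neg hx, ih]

/-- `T₀ ^ e ≡ id (mod M)` for a separating partial conjugation, if `M ◁ S` contains all `e`-th
powers (`T₀^e(x)x⁻¹ = w^e · (x w^{-e} x⁻¹)`). -/
theorem congruentMod_pow_of_isSepTwist {m : ℕ} {M : Subgroup (Sg m)} [M.Normal] {h : ℕ}
    {T : Sg m ≃* Sg m} (hT : IsSepTwist h T) {e : ℕ} (he : ∀ s : Sg m, s ^ e ∈ M) :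
    CongruentMod M (T ^ e) := by
  refine congruentMod_of_generators ?_
  intro x
  by_cases hx : x.1.val < h
  · rw [pow_apply_of_isSepTwist_lt hT e hx]
    have h1 : boundaryWord m h ^ e ∈ M := he _
    have h2 : PresentedGroup.of x * (boundaryWord m h ^ e)⁻¹ * (PresentedGroup.of x)⁻¹ ∈ M :=
      Subgroup.Normal.conj_mem inferInstance _ (M.inv_mem h1) _
    have h3 := M.mul_mem h1 h2
    simpa [mul_assoc] using h3
  · rw [pow_apply_of_isSepTwist_not_lt hT e hx, mul_inv_cancel]
    exact M.one_mem

/-- The base twists are absorbed. -/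
theorem congruentMod_pow_of_base {m : ℕ} {M : Subgroup (Sg m)} [M.Normal]
    {T : Sg m ≃* Sg m} (hT : IsStdTwist T ∨ ∃ h : ℕ, IsSepTwist h T) {e : ℕ}
    (he : ∀ s : Sg m, s ^ e ∈ M) : CongruentMod M (T ^ e) := by
  rcases hT with hT | ⟨h, hT⟩
  · exact congruentMod_pow_of_isStdTwist hT he
  · exact congruentMod_pow_of_isSepTwist hT he

/-- **STUB 2 holds**: power-twist absorption. -/
theorem twistAbsorption_proof : TwistAbsorption := by
  intro m e M hM he t ht
  haveI : M.Characteristic := hM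
  haveI : (congruenceKernel M).Normal := congruenceKernel_normal hM
  have hsub : {t | ∃ T : Sg m ≃* Sg m, IsDehnTwist T ∧ t = T ^ e} ⊆
      ((congruenceKernel M : Subgroup (Sg m ≃* Sg m)) : Set (Sg m ≃* Sg m)) := by
    rintro _ ⟨T, ⟨φ, T₀, hT₀, rfl⟩, rfl⟩
    change CongruentMod M ((φ * T₀ * φ⁻¹) ^ e)
    rw [conj_pow]
    exact CongruentMod.conj hM (congruentMod_pow_of_base hT₀ he) φ
  have hle : powerTwists m e ≤ congruenceKernel M := Subgroup.normalClosure_le_normal hsub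
  exact hle ht


/-! ## §N  drefute: LOAD-BEARING ANALYSIS of STUB 1 `stub_powerTwistGate` (= `PowerTwistGate`)

Each hypothesis / factor of the mod-`e` gate is dropped in turn; the mutated statement is refuted by
a genus-3 witness at `e = 2`, using STUB 2 (proved above) to see `Mod₃[2]` die modulo the abelian
level `M₂ = ⋂ ker (S₃ →* ℤ/2) = [S,S]S²`. Dropping the twist factor `t` instead gives EXACTLY the
normalised unstable gate (`trivialTwist_iff_normalisedUnstableStandard`), i.e. SPC4 ∧ balanced
4-d Waldhausen in AGK's dictionary — open, not refutable. -/

open Summit.SmoothPoincare4.SmoothPoincare4.Theorems.ShadowsStandard.Negative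
  (N levelSubgroup levelSubgroup_le_ker levelSubgroup_characteristic genChar genChar_of_self
    genChar_of_ne of_not_mem_ker_genChar rotatedKernels rotatedKernels_isGroupTrisection)
open Summit.SmoothPoincare4.SmoothPoincare4.Theorems.WaldhausenPairs.Negative
  (dehnEquiv dehnEquiv_a dehnEquiv_b_of_ne dehnEquiv_b_self map_dehnZero_s4Kernels_zero
    map_dehnZero_s4Kernels_one)

/-- Twist absorption fixes shadows (copied from the skeleton). -/
theorem map_sup_eq_of_congruentMod {m : ℕ} (M : Subgroup (Sg m)) (φ : Sg m ≃* Sg m)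
    (hφ : CongruentMod M φ) (K : Subgroup (Sg m)) :
    (K ⊔ M).map φ.toMonoidHom = K ⊔ M := by
  apply le_antisymm
  · rintro _ ⟨x, hx, rfl⟩
    have h1 : φ x * x⁻¹ ∈ K ⊔ M := Subgroup.mem_sup_right (hφ x)
    have h2 : (φ x * x⁻¹) * x ∈ K ⊔ M := Subgroup.mul_mem _ h1 hx
    simpa using h2
  · intro x hx
    refine ⟨φ.symm x, ?_, by simp⟩
    have h1 : φ (φ.symm x) * (φ.symm x)⁻¹ ∈ M := hφ (φ.symm x)
    rw [MulEquiv.apply_symm_apply] at h1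
    have h2 : (x * (φ.symm x)⁻¹)⁻¹ * x ∈ K ⊔ M :=
      Subgroup.mul_mem _ (Subgroup.inv_mem _ (Subgroup.mem_sup_right h1)) hx
    have h3 : (x * (φ.symm x)⁻¹)⁻¹ * x = φ.symm x := by group
    simpa [h3] using h2

/-- A congruent automorphism maps `M` onto itself (copied from the skeleton). -/
theorem map_eq_of_congruentMod {m : ℕ} (M : Subgroup (Sg m)) (φ : Sg m ≃* Sg m)
    (hφ : CongruentMod M φ) : M.map φ.toMonoidHom = M := by
  simpa using map_sup_eq_of_congruentMod M φ hφ M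

/-- The statement of STUB 1 (copied from the skeleton). -/
def PowerTwistGate : Prop :=
  ∀ (m e : ℕ), 2 ≤ e → ∀ K : TrisectionKernels (3 + 3 * m),
    IsGroupTrisection (3 + 3 * m) (m + 1) (PUnit : Type) K → K 0 = N m 0 → K 1 = N m 1 →
    ∃ y t c : Sg m ≃* Sg m,
      (N m 0).map y.toMonoidHom = N m 0 ∧ (N m 1).map y.toMonoidHom = N m 1 ∧
      t ∈ powerTwists m e ∧ (N m 2).map c.toMonoidHom = N m 2 ∧
      K 2 = (((N m 2).map c.toMonoidHom).map t.toMonoidHom).map y.toMonoidHom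

/-! ### The abelian level `M₂` at genus 3 and the death of `Mod₃[2]` modulo `M₂` -/

/-- `M₂ = ⋂ ker (S₃ →* ℤ/2)` (= `[S,S]·S²`), a characteristic finite-index level of `S₃ = Sg 0`. -/
abbrev M2 : Subgroup (Sg 0) := levelSubgroup 3 (Multiplicative (ZMod 2))

theorem sq_mem_M2 (s : Sg 0) : s ^ 2 ∈ M2 := by
  refine Subgroup.mem_iInf.2 fun φ => ?_
  rw [MonoidHom.mem_ker, map_pow]
  generalize φ s = x
  revert x
  decide

theorem M2_characteristic : M2.Characteristic := levelSubgroup_characteristic 3 _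

/-- By STUB 2 (proved): every element of `powerTwists 0 2 = Mod₃[2]` (based) is congruent to the
identity modulo `M₂`. -/
theorem congruentMod_M2_of_mem_powerTwists {t : Sg 0 ≃* Sg 0} (ht : t ∈ powerTwists 0 2) :
    CongruentMod M2 t :=
  twistAbsorption_proof 0 2 M2 M2_characteristic sq_mem_M2 t ht

/-- The character of handle `0`: `a₀, b₀ ↦ 1 ∈ ℤ/2`, all other generators `↦ 0`. -/
def handleZeroChar : Sg 0 →* Multiplicative (ZMod 2) :=
  Summit.SmoothPoincare4.SmoothPoincare4.Theorems.ShadowsStandard.Negative.abelianHom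
    fun x : surfaceGen 3 => if x.1 = 0 then Multiplicative.ofAdd (1 : ZMod 2) else 1

theorem handleZeroChar_of (x : surfaceGen 3) :
    handleZeroChar (PresentedGroup.of x) =
      if x.1 = 0 then Multiplicative.ofAdd (1 : ZMod 2) else 1 := by
  simp [handleZeroChar]

/-! ### (N1) The Goeritz factor `y` is load-bearing: `Mod_g[e]·C` alone does not reach `K₂` -/

/-- Natural strengthening of STUB 1: no Goeritz factor (`y = 1`; equivalently `y ∈ A ∩ B ∩ C`):
`K₂ ∈ Mod_g[e] · C · N₂`. -/
def PowerTwistGateTrivialGoeritz : Prop :=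
  ∀ (m e : ℕ), 2 ≤ e → ∀ K : TrisectionKernels (3 + 3 * m),
    IsGroupTrisection (3 + 3 * m) (m + 1) (PUnit : Type) K → K 0 = N m 0 → K 1 = N m 1 →
    ∃ t c : Sg m ≃* Sg m,
      t ∈ powerTwists m e ∧ (N m 2).map c.toMonoidHom = N m 2 ∧
      K 2 = ((N m 2).map c.toMonoidHom).map t.toMonoidHom

/-- **REFUTED STRENGTHENING (N1).** Witness: `m = 0`, `e = 2`, `K = T₀ • N` with `T₀ = dehnEquiv 0`
(the twist about the curve `a₁` shared by `N₀, N₁`; `T₀ ∈ A ∩ B`, a genuine `(3;1)` group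
trisection of `{1}` with standard spine, isomorphic to `N`). Modulo `M₂` the factor `t` dies
(STUB 2) and `c` fixes `N₂`, so `T₀N₂ ⊔ M₂ = N₂ ⊔ M₂` would follow; but the character of handle
`0` kills `T₀N₂ = ⟪b₁a₁, a₂, a₃⟫` and `M₂`, not `b₁ ∈ N₂`. So the EXACT Goeritz element must move
`N₂` already at the first level: `Mod₃[2]`-moves plus `H₂`-handlebody moves do not generate it. -/
theorem not_powerTwistGateTrivialGoeritz : ¬ PowerTwistGateTrivialGoeritz := by
  intro h
  let K : TrisectionKernels 3 := fun i => (s4Kernels i).map (dehnEquiv 0).toMonoidHom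
  have hK : IsGroupTrisection 3 1 (PUnit : Type) K :=
    Summit.SmoothPoincare4.SmoothPoincare4.Theorems.WaldhausenPairs.Negative.IsGroupTrisection.map_mulEquiv
      s4Kernels_isGroupTrisection_holds (dehnEquiv 0)
  obtain ⟨t, c, ht, hc, hK2⟩ :=
    h 0 2 le_rfl K hK map_dehnZero_s4Kernels_zero map_dehnZero_s4Kernels_one
  have htc : CongruentMod M2 t := congruentMod_M2_of_mem_powerTwists ht
  have key : K 2 ⊔ M2 = s4Kernels 2 ⊔ M2 := by
    calc K 2 ⊔ M2 = (N 0 2).map t.toMonoidHom ⊔ M2 := by rw [hK2, hc]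
      _ = (N 0 2).map t.toMonoidHom ⊔ M2.map t.toMonoidHom := by
          rw [map_eq_of_congruentMod M2 t htc]
      _ = (N 0 2 ⊔ M2).map t.toMonoidHom := (Subgroup.map_sup _ _ _).symm
      _ = N 0 2 ⊔ M2 := map_sup_eq_of_congruentMod M2 t htc _
      _ = s4Kernels 2 ⊔ M2 := rfl
  -- the character of handle 0 kills `K 2 ⊔ M2` …
  have hK2le : K 2 ≤ handleZeroChar.ker := by
    change (s4Kernels 2).map (dehnEquiv 0).toMonoidHom ≤ handleZeroChar.ker
    rw [Subgroup.map_le_iff_le_comap, s4Kernels_eq]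
    refine Subgroup.normalClosure_le_normal ?_
    rintro _ ⟨x, hx, rfl⟩
    rw [SetLike.mem_coe, Subgroup.mem_comap, MonoidHom.mem_ker]
    simp only [s4Gens, Finset.coe_insert, Finset.coe_singleton, Matrix.cons_val_two,
      Matrix.tail_cons, Matrix.head_cons, Set.mem_insert_iff, Set.mem_singleton_iff] at hx
    rcases hx with rfl | rfl | rfl
    · change handleZeroChar (dehnEquiv 0 (SurfaceGroup.b 0)) = 1
      rw [dehnEquiv_b_self, map_mul]
      change handleZeroChar (PresentedGroup.of ((0 : Fin 3), true)) *
        handleZeroChar (PresentedGroup.of ((0 : Fin 3), false)) = 1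
      rw [handleZeroChar_of, handleZeroChar_of]
      decide
    · change handleZeroChar (dehnEquiv 0 (SurfaceGroup.a 1)) = 1
      rw [dehnEquiv_a]
      change handleZeroChar (PresentedGroup.of ((1 : Fin 3), false)) = 1
      rw [handleZeroChar_of]
      decide
    · change handleZeroChar (dehnEquiv 0 (SurfaceGroup.a 2)) = 1
      rw [dehnEquiv_a]
      change handleZeroChar (PresentedGroup.of ((2 : Fin 3), false)) = 1
      rw [handleZeroChar_of]
      decide
  have hM2le : M2 ≤ handleZeroChar.ker := levelSubgroup_le_ker _
  have hsup : K 2 ⊔ M2 ≤ handleZeroChar.ker := sup_le hK2le hM2le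
  rw [key] at hsup
  -- … but not `b₁ ∈ N₂`
  have hb : (SurfaceGroup.b 0 : Sg 0) ∈ s4Kernels 2 ⊔ M2 :=
    Subgroup.mem_sup_left (of_mem_s4Kernels 2 (x := ((0 : Fin 3), true)) (by decide))
  have := hsup hb
  rw [MonoidHom.mem_ker] at this
  change handleZeroChar (PresentedGroup.of ((0 : Fin 3), true)) = 1 at this
  rw [handleZeroChar_of] at this
  revert this
  decide

/-! ### (N2) The normalisation `K₀ = N₀, K₁ = N₁` is load-bearing -/

/-- STUB 1 without the normalisation hypotheses. -/
def PowerTwistGateWithoutNormalisation : Prop :=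
  ∀ (m e : ℕ), 2 ≤ e → ∀ K : TrisectionKernels (3 + 3 * m),
    IsGroupTrisection (3 + 3 * m) (m + 1) (PUnit : Type) K →
    ∃ y t c : Sg m ≃* Sg m,
      (N m 0).map y.toMonoidHom = N m 0 ∧ (N m 1).map y.toMonoidHom = N m 1 ∧
      t ∈ powerTwists m e ∧ (N m 2).map c.toMonoidHom = N m 2 ∧
      K 2 = (((N m 2).map c.toMonoidHom).map t.toMonoidHom).map y.toMonoidHom

/-- `N₀ = ⟪a₁, a₂, b₃⟫` dies under the character `χ_{b₁}`. -/
theorem s4Kernels_zero_le_ker_genChar_b0 :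
    s4Kernels 0 ≤ (genChar (((0 : Fin 3), true) : surfaceGen 3)).ker := by
  rw [s4Kernels_eq]
  refine Subgroup.normalClosure_le_normal ?_
  rintro _ ⟨x, hx, rfl⟩
  rw [SetLike.mem_coe, MonoidHom.mem_ker]
  refine genChar_of_ne ?_
  rintro rfl
  revert hx
  decide

/-- **LOAD-BEARING (N2).** Witness: `m = 0`, `e = 2`, the RELABELLED standard triple
`K = N ∘ finRotate 3 = (N₁, N₂, N₀)` (a `(3;1)` group trisection of `{1}`). A gate factorisation
`N₀ = K₂ = y t c N₂` with `y ∈ A ∩ B` gives, modulo `M₂` (where `t` dies by STUB 2),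
`y(N₂ ⊔ M₂) = N₀ ⊔ M₂ = y(N₀ ⊔ M₂)`, hence `N₂ ⊔ M₂ = N₀ ⊔ M₂`, refuted by `χ_{b₁}`. -/
theorem not_powerTwistGateWithoutNormalisation : ¬ PowerTwistGateWithoutNormalisation := by
  intro h
  obtain ⟨y, t, c, hy0, _hy1, ht, hc, hK2⟩ :=
    h 0 2 le_rfl rotatedKernels rotatedKernels_isGroupTrisection
  have htc : CongruentMod M2 t := congruentMod_M2_of_mem_powerTwists ht
  have hyM : M2.map y.toMonoidHom = M2 := (characteristic_iff_map_eq.1 M2_characteristic) y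
  have hrot : rotatedKernels 2 = N 0 0 := rfl
  have key : (N 0 2 ⊔ M2).map y.toMonoidHom = (N 0 0 ⊔ M2).map y.toMonoidHom := by
    calc (N 0 2 ⊔ M2).map y.toMonoidHom
          = ((N 0 2 ⊔ M2).map t.toMonoidHom).map y.toMonoidHom := by
            rw [map_sup_eq_of_congruentMod M2 t htc]
      _ = (((N 0 2).map c.toMonoidHom).map t.toMonoidHom ⊔ M2.map t.toMonoidHom).map
            y.toMonoidHom := by rw [hc, Subgroup.map_sup]
      _ = (((N 0 2).map c.toMonoidHom).map t.toMonoidHom).map y.toMonoidHom ⊔ M2 := by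
            rw [map_eq_of_congruentMod M2 t htc, Subgroup.map_sup, hyM]
      _ = rotatedKernels 2 ⊔ M2 := by rw [← hK2]
      _ = N 0 0 ⊔ M2 := by rw [hrot]
      _ = (N 0 0 ⊔ M2).map y.toMonoidHom := by rw [Subgroup.map_sup, hy0, hyM]
  have key' : N 0 2 ⊔ M2 = N 0 0 ⊔ M2 := Subgroup.map_injective y.injective key
  have hle : N 0 0 ⊔ M2 ≤ (genChar (((0 : Fin 3), true) : surfaceGen 3)).ker :=
    sup_le s4Kernels_zero_le_ker_genChar_b0 (levelSubgroup_le_ker _)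
  rw [← key'] at hle
  have hb : (SurfaceGroup.b 0 : Sg 0) ∈ N 0 2 ⊔ M2 :=
    Subgroup.mem_sup_left (of_mem_s4Kernels 2 (x := ((0 : Fin 3), true)) (by decide))
  exact of_not_mem_ker_genChar _ (hle hb)

/-! ### (N3) `IsGroupTrisection` is load-bearing (junk third kernel) -/

/-- STUB 1 without the trisection hypothesis. -/
def PowerTwistGateWithoutTrisection : Prop :=
  ∀ (m e : ℕ), 2 ≤ e → ∀ K : TrisectionKernels (3 + 3 * m), K 0 = N m 0 → K 1 = N m 1 →
    ∃ y t c : Sg m ≃* Sg m,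
      (N m 0).map y.toMonoidHom = N m 0 ∧ (N m 1).map y.toMonoidHom = N m 1 ∧
      t ∈ powerTwists m e ∧ (N m 2).map c.toMonoidHom = N m 2 ∧
      K 2 = (((N m 2).map c.toMonoidHom).map t.toMonoidHom).map y.toMonoidHom

/-- **LOAD-BEARING (N3).** Witness `K = (N₀, N₁, ⊥)` at `m = 0`, `e = 2`: automorphic images of
`N₂ ≠ ⊥` are never `⊥`. -/
theorem not_powerTwistGateWithoutTrisection : ¬ PowerTwistGateWithoutTrisection := by
  intro h
  obtain ⟨y, t, c, _hy0, _hy1, _ht, _hc, hK2⟩ := h 0 2 le_rfl ![s4Kernels 0, s4Kernels 1, ⊥] rfl rfl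
  have hbot : (((N 0 2).map c.toMonoidHom).map t.toMonoidHom).map y.toMonoidHom = ⊥ := by
    rw [← hK2]; rfl
  rw [Subgroup.map_eq_bot_iff_of_injective _ y.injective,
    Subgroup.map_eq_bot_iff_of_injective _ t.injective,
    Subgroup.map_eq_bot_iff_of_injective _ c.injective] at hbot
  have hb : (SurfaceGroup.b 0 : Sg 0) ∈ N 0 2 :=
    of_mem_s4Kernels 2 (x := ((0 : Fin 3), true)) (by decide)
  rw [hbot, Subgroup.mem_bot] at hb
  have := of_not_mem_ker_genChar (((0 : Fin 3), true) : surfaceGen 3)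
  apply this
  rw [MonoidHom.mem_ker]
  change genChar ((0 : Fin 3), true) (SurfaceGroup.b 0) = 1
  rw [hb, map_one]

/-! ### (N4) Dropping the twist factor `t` is the normalised unstable gate (open, not refutable) -/

/-- STUB 1 with `t = 1`: `K₂ ∈ (A ∩ B) · C · N₂ = (A ∩ B) · N₂`. -/
def PowerTwistGateTrivialTwist : Prop :=
  ∀ (m : ℕ) (K : TrisectionKernels (3 + 3 * m)),
    IsGroupTrisection (3 + 3 * m) (m + 1) (PUnit : Type) K → K 0 = N m 0 → K 1 = N m 1 →
    ∃ y c : Sg m ≃* Sg m,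
      (N m 0).map y.toMonoidHom = N m 0 ∧ (N m 1).map y.toMonoidHom = N m 1 ∧
      (N m 2).map c.toMonoidHom = N m 2 ∧
      K 2 = ((N m 2).map c.toMonoidHom).map y.toMonoidHom

/-- Unstable standardness of NORMALISED triples (= `UnstableStandard` of the Disproof file given the
route item `WaldhausenPairs`; SPC4 ∧ balanced 4-d Waldhausen in AGK's dictionary). -/
def NormalisedUnstableStandard : Prop :=
  ∀ (m : ℕ) (K : TrisectionKernels (3 + 3 * m)),
    IsGroupTrisection (3 + 3 * m) (m + 1) (PUnit : Type) K → K 0 = N m 0 → K 1 = N m 1 →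
    TrisectionKernels.Iso (N m) K

/-- **(N4)** without the power-twist slack the gate is exactly the normalised unstable gate. -/
theorem trivialTwist_iff_normalisedUnstableStandard :
    PowerTwistGateTrivialTwist ↔ NormalisedUnstableStandard := by
  constructor
  · intro h m K hK hK0 hK1
    obtain ⟨y, c, hy0, hy1, hc, hK2⟩ := h m K hK hK0 hK1
    refine ⟨y, fun i => ?_⟩
    fin_cases i
    · exact hy0.trans hK0.symm
    · exact hy1.trans hK1.symm
    · change (N m 2).map y.toMonoidHom = K 2
      rw [hK2, hc]
  · intro h m K hK hK0 hK1
    obtain ⟨α, hα⟩ := h m K hK hK0 hK1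
    refine ⟨α, MulEquiv.refl _, ?_, ?_, ?_, ?_⟩
    · rw [hα 0, hK0]
    · rw [hα 1, hK1]
    · exact Subgroup.map_id _
    · change K 2 = ((N m 2).map (MonoidHom.id _)).map α.toMonoidHom
      rw [Subgroup.map_id, hα 2]

/-- `PowerTwistGate` with `t = 1` allowed is implied by the normalised unstable gate (sandwich, upper
slice): `NormalisedUnstableStandard → PowerTwistGate`. -/
theorem powerTwistGate_of_normalisedUnstableStandard (h : NormalisedUnstableStandard) :
    PowerTwistGate := by
  intro m e _ K hK hK0 hK1
  obtain ⟨y, c, hy0, hy1, hc, hK2⟩ :=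
    trivialTwist_iff_normalisedUnstableStandard.2 h m K hK hK0 hK1
  refine ⟨y, 1, c, hy0, hy1, Subgroup.one_mem _, hc, ?_⟩
  rw [hK2]
  congr 1
  change _ = ((N m 2).map c.toMonoidHom).map (MonoidHom.id _)
  rw [Subgroup.map_id]

/-! ### (N5) The exponent hypothesis: at `e = 0` the power subgroup is trivial, so `PowerTwistGate`
restricted to `e = 0` would again be the normalised unstable gate (this is why `2 ≤ e`; at `e = 1`
the power subgroup contains every Dehn twist and the gate is vacuous by Dehn–Lickorish). -/

theorem powerTwists_zero (m : ℕ) : powerTwists m 0 = ⊥ := by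
  rw [eq_bot_iff]
  refine Subgroup.normalClosure_le_normal ?_
  rintro _ ⟨T, _, rfl⟩
  simp


/-! ### (N6) The handlebody factor `c` is decoration: `c(N₂) = N₂` is substituted away -/

/-- STUB 1 without the factor `c`. -/
def PowerTwistGateNoHandlebodyFactor : Prop :=
  ∀ (m e : ℕ), 2 ≤ e → ∀ K : TrisectionKernels (3 + 3 * m),
    IsGroupTrisection (3 + 3 * m) (m + 1) (PUnit : Type) K → K 0 = N m 0 → K 1 = N m 1 →
    ∃ y t : Sg m ≃* Sg m,
      (N m 0).map y.toMonoidHom = N m 0 ∧ (N m 1).map y.toMonoidHom = N m 1 ∧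
      t ∈ powerTwists m e ∧ K 2 = ((N m 2).map t.toMonoidHom).map y.toMonoidHom

/-- **(N6)** `PowerTwistGate ↔ PowerTwistGateNoHandlebodyFactor`: the statement is
`K₂ ∈ (A∩B) · Mod_g[e] · N₂`; the `∃ c ∈ C` adds nothing (take `c = 1`). -/
theorem powerTwistGate_iff_noHandlebodyFactor :
    PowerTwistGate ↔ PowerTwistGateNoHandlebodyFactor := by
  constructor
  · intro h m e he K hK hK0 hK1
    obtain ⟨y, t, c, hy0, hy1, ht, hc, hK2⟩ := h m e he K hK hK0 hK1
    exact ⟨y, t, hy0, hy1, ht, by rw [hK2, hc]⟩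
  · intro h m e he K hK hK0 hK1
    obtain ⟨y, t, hy0, hy1, ht, hK2⟩ := h m e he K hK hK0 hK1
    refine ⟨y, t, MulEquiv.refl _, hy0, hy1, ht, Subgroup.map_id _, ?_⟩
    rw [hK2]
    congr 2
    exact (Subgroup.map_id _).symm

/-! ### (N7) Inner automorphisms lie in every stabiliser: the gate is a statement in `Out S = Mod^±`
(so the finite computation of the `(0,3)` rung may be run in `Mod₃^± / Mod₃[3]`, where Humphries'
finiteness lives, regardless of whether the BASED quotient `Aut S₃ ⧸ powerTwists 0 3` is finite). -/

theorem map_conj_eq_of_normal {m : ℕ} (H : Subgroup (Sg m)) [H.Normal] (s : Sg m) :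
    H.map (MulAut.conj s).toMonoidHom = H := by
  apply le_antisymm
  · rintro _ ⟨x, hx, rfl⟩
    exact Subgroup.Normal.conj_mem inferInstance x hx s
  · intro x hx
    refine ⟨s⁻¹ * x * s⁻¹⁻¹, Subgroup.Normal.conj_mem inferInstance x hx s⁻¹, ?_⟩
    simp [MulAut.conj_apply, mul_assoc]

/-- Every inner automorphism stabilises all three standard kernels (they are normal). -/
theorem inner_mem_stabilisers (m : ℕ) (s : Sg m) (i : Fin 3) :
    (N m i).map (MulAut.conj s).toMonoidHom = N m i := by
  haveI : (N m i).Normal :=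
    (Summit.SmoothPoincare4.SmoothPoincare4.Theorems.ShadowsStandard.Negative.stabilizeIter_isGroupTrisection
      m).normal i
  exact map_conj_eq_of_normal _ s

end Summit.SmoothPoincare4.SmoothPoincare4.Cruxes.ShadowsStandard.PowerTwistAbsorption

end
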